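import Summits.Ventures.QEC.Census.CertBZPlane
import Summits.Ventures.QEC.Census.TwoBGA.TB_l7m21_A0_0_0_3_2_18_B0_0_1_1_5_5.Cert
import HarnessLib

/-!
# `TB_l7m21_A0_0_0_3_2_18_B0_0_1_1_5_5` — lane-engine replays, part 1/3 (census row `2bga-l7m21-A0-0.0-3.2-18-B0-0.1-1.5-5`; qec-search-4 orbit lane, emitted by qec-type-08 g7)

`Plane.segOK` verdicts (type-01 lane engine, `decide +kernel`) for segments of the kernel-basis replays of the views of
`Census/TwoBGA/TB_l7m21_A0_0_0_3_2_18_B0_0_1_1_5_5/`; assembled in `Distance.lean`.  Generated by `tools/gen4/emit_orbit_row.py`; do not edit by hand.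
-/

set_option autoImplicit false
set_option Elab.async false

namespace Summit.Ventures.QEC.Census.TB_l7m21_A0_0_0_3_2_18_B0_0_1_1_5_5

open Summit.Ventures.QEC.Census

set_option maxHeartbeats 400000000 in
/-- `Z` view 0, lane segment `[0, 112)` (6445068 lanes, depth 4, threshold 9; est 85 s): every selection with largest row there passes (lane engine, KERNEL). -/
theorem psegZ_0_0 : Plane.segOK 294 9 (TB_l7m21_A0_0_0_3_2_18_B0_0_1_1_5_5.cert.sideZ.found.map Prod.fst) TB_l7m21_A0_0_0_3_2_18_B0_0_1_1_5_5.pGZ_0 4 0 112 54 = true := by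
  decide +kernel

set_option maxHeartbeats 400000000 in
/-- `Z` view 0, lane segment `[112, 133)` (6404594 lanes, depth 4, threshold 9; est 64 s): every selection with largest row there passes (lane engine, KERNEL). -/
theorem psegZ_0_1 : Plane.segOK 294 9 (TB_l7m21_A0_0_0_3_2_18_B0_0_1_1_5_5.cert.sideZ.found.map Prod.fst) TB_l7m21_A0_0_0_3_2_18_B0_0_1_1_5_5.pGZ_0 4 112 21 54 = true := by
  decide +kernel

end Summit.Ventures.QEC.Census.TB_l7m21_A0_0_0_3_2_18_B0_0_1_1_5_5
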